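import Summits.QuantumFields.BalabanUV.T4Continuum.Support.NE7ClassCurrentBoundGeneric
import Summits.QuantumFields.BalabanUV.T4Continuum.Support.NE7AllMinimisersHolderRegGeneric
import Summits.QuantumFields.BalabanUV.T4Continuum.Support.MinimalActionClassSix
import HarnessLib

/-!
# NE7AllMinimisersRegularSpaceGeneric — EVERY CONSTRAINED SMALL-FIELD MINIMISER LIES IN THE REGULAR SPACE OF [Balaban1985RegularSpaces] (1.7) ∧ (1.9) TYPE AT ITS OWN
# SCALE, k-UNIFORMLY AND WITHOUT LOGARITHM (`d = 4`, any `L ≥ 2`, any `U(n)`): `∃ C ≥ 0, ∃ ε₀ > 0, ∀ 0 < ε ≤ ε₀, ∀ N ≥ 1, ∃ δ_V > 0`, for every datum of the small data, every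
# level `k` and every minimiser `U` at level `k`:  (1.7)-TYPE `SmallField U (ε∕M²)` and (1.9)-TYPE `‖(D*_U ∂U)_ν(y)‖ = ‖covDiv 1 U ν y‖ ≤ C·ε∕M³` at every bond (`M = L^k`)
# — the small-CURRENT clause (the equation-level, log-free half of print's (10)) next to gen 111's (9)-TYPE Hölder letter ✓ p814290 (β < 1; the all-components flux
# gradient keeps its logarithm, j342950)

Cell `pub-balaban`, rung (B)+1 sub-cell t4, lineage `b2b-balaban-t4-ne7-p1` (CRUX PROVER NE7 #1 = OWNER of BINDER row NE7), generation 111.  Memo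
`t4/b2b-balaban-t4-ne7-p1-g111/ROAD-G111.md` §7.  File F8: the (1.9)∕(10)-current companion of the (9)-type line.  Over ✓ `NE7ClassCurrentBoundGeneric.exists_classCurrentConst_generic`
(the class letter at a tangent-critical configuration, levels `k+1`), interiority ✓ p810303 `all_minimisers_small_generic`, the Fermat theorem `tanCritical_of_isMinimiser`, the class
package; level `0` by `MinimalActionClassSix.norm_covDiv_le` (`6ε`).
WHAT ([folklore]; 0 def, 0 sorry).  **`all_minimisers_regularSpace_generic`** (displayed above; `C = max C_cur 6` with `C_cur` the class-current constant at `r = ε∕4`... read `C·ε`).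
HONEST FRAMING (page 1): OUR minimisers (B11 (8) with `sfClass`), OUR route; (1.7)∧(1.9) are the HYPOTHESIS CLASS of [B8] Thm 2 ∕ [B11] Thm 1, here MET by our minimisers — NOT those
theorems; nothing of Bałaban's asserted; NE3∕NE7 NOT proved as spine nodes; spine 0∕9; FIXED FINITE T⁴ rung (B)+1 — NOT infinite volume, NOT mass gap, NOT BetaPertH, NOT Clay.
-/

set_option autoImplicit false

open scoped BigOperators Matrix Matrix.Norms.L2Operator
open NormedSpace Finset

namespace Summit.QuantumFields.BalabanUV.T4Continuum.NE7AllMinimisersRegularSpaceGeneric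

open Literature.MathematicalPhysics.QuantumFieldTheory.Balaban1983to89
open B7Prop1Explicit B7Prop2Explicit
open B7Eq78Linearization (conjR conjR_sub conjR_one)
open B8Ineq132 (plaqF covDiv norm_conjR)
open T4AveragingDeficitWall (IsUnitaryCfg IsSkewDir SmallField)
open T4AveragingDeficitWallBoundary (IsPeriodicCfg periodBox)
open AveragingDeficitPeriodicCounting (IsPeriodicDir)
open AveragingDeficitTransport (mem_U1_of_unitary)
open AveragingDeficitMultiLevelPrep (LevelSmall TangentIter)
open MinimalActionSandwich (IsMinimiser admissible)
open MinimalActionRate (sfClass)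
open MinimalActionClassSix (norm_covDiv_le)
open NE3RightInverseSolveLetters (thetaLoc thetaLoc_nonneg)
open NE7AllMinimisersSmallGeneric (all_minimisers_small_generic)
open NE7OpenOfMinimisation (tanCritical_of_isMinimiser)
open NE7ClassCurrentBoundGeneric (exists_classCurrentConst_generic)
open NE7EnergyClassPoincareGeneric (classPackage)

noncomputable section

variable {n : Type} [Fintype n] [DecidableEq n]

/-- Level `0` (no constraint structure needed): `SmallField U ε` on unitary `U` gives `‖covDiv 1 U μ x‖ ≤ 6ε` in `d = 4` (each transported backward plaquette difference is
`≤ 2ε`; `MinimalActionClassSix.norm_covDiv_le`). [folklore] -/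
theorem norm_covDiv_le_of_smallField [Nonempty n] {U : Site 4 → Fin 4 → (Matrix n n ℂ)ˣ} (hUu : IsUnitaryCfg U) {ε : ℝ} (hS : SmallField U ε)
    (μ : Fin 4) (x : Site 4) : ‖covDiv 1 U μ x‖ ≤ 6 * ε := by
  have hU1 : ∀ z κ, U z κ ∈ U1 (Matrix n n ℂ) := fun z κ => mem_U1_of_unitary (hUu z κ)
  have hP : ∀ (κ κ' : Fin 4) (z : Site 4), κ ≠ κ' → ‖plaqF U κ κ' z - 1‖ ≤ ε := fun κ κ' z h => hS z κ κ' h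
  have hpair : ∀ (κ κ' : Fin 4) (ν : Fin 4) (z : Site 4), κ ≠ κ' →
      ‖conjR (U (x - e ν) ν)⁻¹ (plaqF U κ κ' z) - plaqF U κ κ' x‖ ≤ 2 * ε := by
    intro κ κ' ν z hκ
    have h1 : ‖conjR (U (x - e ν) ν)⁻¹ (plaqF U κ κ' z) - 1‖ ≤ ε := by
      rw [← conjR_one (U (x - e ν) ν)⁻¹, ← conjR_sub, norm_conjR ((U1 _).inv_mem (hU1 _ _))]
      exact hP κ κ' z hκ
    have h2 : ‖plaqF U κ κ' x - 1‖ ≤ ε := hP κ κ' x hκ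
    calc _ = ‖(conjR (U (x - e ν) ν)⁻¹ (plaqF U κ κ' z) - 1) - (plaqF U κ κ' x - 1)‖ := by congr 1; abel
      _ ≤ ε + ε := (norm_sub_le _ _).trans (add_le_add h1 h2)
      _ = 2 * ε := by ring
  have h := norm_covDiv_le 1 U μ x (t := 2 * ε) (fun ν hν => hpair ν μ ν (x - e ν) (ne_of_lt hν)) (fun ν hν => hpair μ ν ν (x - e ν) (ne_of_lt hν))
  calc _ ≤ |(1 : ℝ)|⁻¹ * ((((4 : ℕ) : ℝ) - 1) * (2 * ε)) := h
    _ = 6 * ε := by norm_num; ring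

set_option maxHeartbeats 400000 in
/-- **EVERY CONSTRAINED MINIMISER IS IN THE REGULAR SPACE (1.7) ∧ (1.9) TYPE AT ITS OWN SCALE, k-UNIFORMLY, NO LOGARITHM** (statement in the file header). [folklore] -/
theorem all_minimisers_regularSpace_generic [Nonempty n] {L : ℕ} (hL : 2 ≤ L) :
    ∃ C : ℝ, 0 ≤ C ∧ ∃ ε₀ : ℝ, 0 < ε₀ ∧ ∀ ε : ℝ, 0 < ε → ε ≤ ε₀ → ∀ (N : ℕ) [NeZero N], 1 ≤ N →
      ∃ δV : ℝ, 0 < δV ∧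
        ∀ V ∈ {V : Site 4 → Fin 4 → (Matrix n n ℂ)ˣ | IsUnitaryCfg V ∧ IsPeriodicCfg V (N : ℤ) ∧ SmallField V δV},
        ∀ (k : ℕ) (U : Site 4 → Fin 4 → (Matrix n n ℂ)ˣ), IsMinimiser 4 (sfClass 4 L N ε) L N k V U →
          SmallField U (ε / ((L : ℝ) ^ k) ^ 2) ∧
          ∀ (ν : Fin 4) (y : Site 4), ‖covDiv 1 U ν y‖ ≤ C * ε / ((L : ℝ) ^ k) ^ 3 := by
  haveI : NeZero L := ⟨by omega⟩
  have hL1 : 1 ≤ L := Nat.le_trans (by norm_num) hL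
  obtain ⟨ε₁, hε₁, H1⟩ := all_minimisers_small_generic (n := n) hL
  obtain ⟨C, hC, H2⟩ := exists_classCurrentConst_generic (n := n) hL
  obtain ⟨θ₀, CF, CE, hθ₀, -, -, -, -, -, hls, -, -⟩ := classPackage (n := n) (d := 4) (by norm_num) hL
  have hθL : 0 ≤ thetaLoc 4 L := thetaLoc_nonneg 4 L
  have hθpos : 0 < 2 * thetaLoc 4 L + 1 := by linarith
  refine ⟨max (C / 4) 6, le_max_of_le_right (by norm_num), min ε₁ (min θ₀ (min 1 (1 / (2 * thetaLoc 4 L + 1)))),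
    lt_min hε₁ (lt_min hθ₀ (lt_min one_pos (by positivity))), ?_⟩
  intro ε hε hεle N _ hN
  have hεε₁ : ε ≤ ε₁ := hεle.trans (min_le_left _ _)
  have hεθ₀ : ε ≤ θ₀ := hεle.trans ((min_le_right _ _).trans (min_le_left _ _))
  have hε1 : ε ≤ 1 := hεle.trans ((min_le_right _ _).trans ((min_le_right _ _).trans (min_le_left _ _)))
  have hεθL : ε ≤ 1 / (2 * thetaLoc 4 L + 1) := hεle.trans ((min_le_right _ _).trans ((min_le_right _ _).trans (min_le_right _ _)))
  have hθline : 2 * thetaLoc 4 L * ε ≤ 1 := by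
    have h1 : 2 * thetaLoc 4 L * ε ≤ 2 * thetaLoc 4 L * (1 / (2 * thetaLoc 4 L + 1)) := mul_le_mul_of_nonneg_left hεθL (by positivity)
    have h2 : 2 * thetaLoc 4 L * (1 / (2 * thetaLoc 4 L + 1)) ≤ 1 := by
      rw [← mul_div_assoc, mul_one, div_le_one hθpos]; linarith
    exact h1.trans h2
  have hlsε : ∀ k : ℕ, LevelSmall 4 L k (ε / ((L : ℝ) ^ (k + 1)) ^ 2) := hls hε.le hεθ₀
  obtain ⟨δV, hδV, Hsmall⟩ := H1 ε hε hεε₁ N hN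
  refine ⟨δV, hδV, ?_⟩
  intro V hV k U hmin
  refine ⟨hmin.mem.1.2.2, fun ν y => ?_⟩
  have hCmax : C / 4 ≤ max (C / 4) 6 := le_max_left _ _
  have h6max : (6 : ℝ) ≤ max (C / 4) 6 := le_max_right _ _
  cases k with
  | zero =>
      have hUu : IsUnitaryCfg U := hmin.mem.1.1
      have hUx : SmallField U (ε / ((L : ℝ) ^ 0) ^ 2) := hmin.mem.1.2.2
      rw [pow_zero, one_pow, div_one] at hUx
      have h := norm_covDiv_le_of_smallField hUu hUx ν y
      rw [pow_zero, one_pow, div_one]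
      nlinarith
  | succ j =>
      have hUa := Hsmall V hV (j + 1) U hmin
      have ha0 : 0 ≤ (ε / 4) / ((L : ℝ) ^ (j + 1)) ^ 2 := by positivity
      have haε : (ε / 4) / ((L : ℝ) ^ (j + 1)) ^ 2 < ε / ((L : ℝ) ^ (j + 1)) ^ 2 :=
        div_lt_div_of_pos_right (by linarith) (by positivity)
      have hcrit := tanCritical_of_isMinimiser (d := 4) (L := L) hL1 hN hmin ha0 haε hUa (hlsε j)
      have h := H2 N ε hε hε1 hθline hlsε V j U hmin.mem hcrit (ε / 4) (by positivity) (by linarith) hUa ν y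
      refine h.trans (div_le_div_of_nonneg_right ?_ (by positivity))
      calc C * (ε / 4) = C / 4 * ε := by ring
        _ ≤ max (C / 4) 6 * ε := mul_le_mul_of_nonneg_right hCmax hε.le

end

end Summit.QuantumFields.BalabanUV.T4Continuum.NE7AllMinimisersRegularSpaceGeneric
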